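import Summits.HubbardSuperconductivity.HubbardSuperconductivity.Theorems.AnisotropyChordStiffnessDoobDefectCycles

/-!
# Route `AnisotropyChord` / H0 rotor rung: GOOD STARTER FAMILIES and the fixed-`L` floor of the converse rung N⁻
# with the combinatorial stubs discharged (theory seat `hubbard-h0-rotor-theory-1`, cycle 10, memo ROTOR-THEORY-10
# §141, §143 work-order v9)

* **`GoodStarterFamily ι L a j ℓ B`** (hypothesis-data): background-wise site-disjoint defect winding cycles of axis `j`
  (`…StiffnessDoobDefectCycles`) of length `≤ ℓ`, `a > 0` on their defect configurations, and for each cycle a set of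
  good starting points with average flatness `B`; `mass F = Σ_{good starters} a(σ)²`;
* (L2) `eq_of_loop_ne_zero` (distinct cycles of the family share no hop-edge), `multiplicity_le` (≤ ℓ good starters per
  hop-edge);
* **`GoodStarterFamily.windingEnergy_ge`** : `L² · mass(F) ≤ (ℓ · 4ℓB²) · W_j(a; g)` for every real potential `g`
  (`L ≥ 2`) — the skeleton `windingEnergy_ge_of_simpleLoops` with `n₀ = ℓ`, `M = 4ℓB²` (loops indexed by good
  starters, whole cycles, no approach leg).
The eventual-in-`L` hypothesis `GoodWindingStarters` and `… ⇒ DoobWindingStiffness ⇒ (S_tw)` are the companion file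
`…StiffnessDoobDefectStiffness`.  Typing authority for the shapes: theory seat memo §143 (v9).
-/

set_option linter.dupNamespace false

noncomputable section

open Matrix Complex Finset Filter Topology
open Literature.MathematicalPhysics.QuantumLattice hiding torusPhase torusNorm
open Literature.Probability.LatticeModels

namespace Summit.HubbardSuperconductivity.HubbardSuperconductivity.Theorems.AnisotropyChord.Stiffness.Doob

variable {L : ℕ} [NeZero L]


/-- **GOOD STARTER FAMILY** (hypothesis-data of the converse rung N⁻, theory seat memo ROTOR-THEORY-10 §143 (v9)):
a finite family of defect winding cycles of axis `j`, of length `≤ ℓ`, BACKGROUND-WISE SITE-DISJOINT (two distinct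
cycles with the same background share no site), with `a > 0` on every defect configuration, and for every cycle a set
`good i` of starting positions `s` at which the defect amplitude profile is flat on average:
`Σ_t (a(config s)/a(config t))² ≤ n·B²`. [folklore] -/
structure GoodStarterFamily (ι : Type) [Fintype ι] [DecidableEq ι] (L : ℕ) [NeZero L]
    (a : TensorIndex (TorusSite 2 L) 2 → ℝ) (j : Fin 2) (ℓ : ℕ) (B : ℝ) where
  /-- the cycles -/
  cyc : ι → DefectCycle L j
  /-- lengths at most `ℓ` -/
  len_le : ∀ i, (cyc i).n ≤ ℓ
  /-- the amplitude is positive on every defect configuration of every cycle -/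
  pos : ∀ i t, 0 < a ((cyc i).config t)
  /-- distinct cycles over the same background are site-disjoint -/
  disjoint : ∀ i i', i ≠ i' → (cyc i).base = (cyc i').base → ∀ t t', (cyc i).site t ≠ (cyc i').site t'
  /-- the good starting positions of cycle `i` -/
  good : ∀ i, Finset (Fin (cyc i).n)
  /-- average flatness at every good starting position -/
  flat : ∀ i, ∀ s ∈ good i,
    ∑ t, (a ((cyc i).config s) / a ((cyc i).config t)) ^ 2 ≤ ((cyc i).n : ℝ) * B ^ 2

namespace GoodStarterFamily

variable {ι : Type} [Fintype ι] [DecidableEq ι] {a : TensorIndex (TorusSite 2 L) 2 → ℝ} {j : Fin 2} {ℓ : ℕ}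
  {B : ℝ} (F : GoodStarterFamily ι L a j ℓ B)

/-- π-mass of the good starters: `Σ_i Σ_{s ∈ good i} a(config s)²`. [folklore] -/
def mass : ℝ := ∑ i, ∑ s ∈ F.good i, a ((F.cyc i).config s) ^ 2

/-- **(L2) Distinct cycles of the family share no hop-edge** (the edge determines the mover and the background;
background-wise disjointness). [folklore] -/
theorem eq_of_loop_ne_zero (hL : 2 ≤ L) {i i' : ι} {e : HopEdge L} (hi : (F.cyc i).loop e ≠ 0)
    (hi' : (F.cyc i').loop e ≠ 0) : i = i' := by
  obtain ⟨t, ht⟩ := Loop.exists_of_walkWeight_ne_zero _ e hi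
  obtain ⟨t', ht'⟩ := Loop.exists_of_walkWeight_ne_zero _ e hi'
  by_contra hne
  have hsite : (F.cyc i).site t = (F.cyc i').site t' := by
    rw [← (F.cyc i).mover_edge hL t, ← (F.cyc i').mover_edge hL t', ht, ht']
  have hbase : (F.cyc i).base = (F.cyc i').base := by
    rw [(F.cyc i).base_eq_of_edge hL t, (F.cyc i').base_eq_of_edge hL t', ht, ht']
  exact F.disjoint i i' hne hbase t t' hsite

/-- (L2′) Multiplicity: at most `ℓ` good starters use a given hop-edge. [folklore] -/
theorem multiplicity_le (hL : 2 ≤ L) (e : HopEdge L) :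
    ((Finset.univ.sigma F.good).filter (fun p => (F.cyc p.1).loop e ≠ 0)).card ≤ ℓ := by
  set T := (Finset.univ.sigma F.good).filter (fun p => (F.cyc p.1).loop e ≠ 0) with hT
  rcases T.eq_empty_or_nonempty with h0 | ⟨p₀, hp₀⟩
  · rw [h0]; simp
  · have hp₀' := (Finset.mem_filter.1 hp₀).2
    have hsub : T ⊆ (Finset.univ : Finset (Fin (F.cyc p₀.1).n)).map
        ⟨fun s => (⟨p₀.1, s⟩ : Σ i, Fin (F.cyc i).n), fun s s' h => eq_of_heq (Sigma.mk.inj h).2⟩ := by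
      intro p hp
      have hp' := (Finset.mem_filter.1 hp).2
      have hi : p.1 = p₀.1 := F.eq_of_loop_ne_zero hL hp' hp₀'
      rw [Finset.mem_map]
      obtain ⟨i, s⟩ := p
      simp only at hi
      subst hi
      exact ⟨s, Finset.mem_univ _, rfl⟩
    calc T.card ≤ ((Finset.univ : Finset (Fin (F.cyc p₀.1).n)).map _).card := Finset.card_le_card hsub
      _ = (F.cyc p₀.1).n := by rw [Finset.card_map, Finset.card_univ, Fintype.card_fin]
      _ ≤ ℓ := F.len_le _

/-- **THE FIXED-`L` FLOOR (N⁻ with the combinatorial stubs discharged).**  For an amplitude `a ≥ 0` on `(ℤ/L)²`,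
`L ≥ 2`, and a good starter family of axis `j` with length bound `ℓ` and flatness `B`:
`L² · mass(F) ≤ (ℓ · 4ℓB²) · W_j(a; g)` for EVERY real potential `g` — the skeleton
`windingEnergy_ge_of_simpleLoops` with `n₀ = ℓ`, `M = 4ℓB²`. [folklore] -/
theorem windingEnergy_ge (hL : 2 ≤ L) (ha : ∀ σ, 0 ≤ a σ) (g : TensorIndex (TorusSite 2 L) 2 → ℝ) :
    (L : ℝ) ^ 2 * F.mass ≤ ((ℓ : ℝ) * (4 * (ℓ : ℝ) * B ^ 2)) * windingEnergy a j g := by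
  classical
  have hmass : F.mass = ∑ p ∈ Finset.univ.sigma F.good, a ((F.cyc p.1).config p.2) ^ 2 := by
    unfold mass; rw [Finset.sum_sigma]
  rw [hmass]
  have h := windingEnergy_ge_of_simpleLoops (Finset.univ.sigma F.good) a ha j (fun p => (F.cyc p.1).loop)
    (fun p _ => ⟨(F.cyc p.1).loop_isCirculation hL, (F.cyc p.1).loop_cond_pos hL a (F.pos p.1),
      (F.cyc p.1).loop_le_one, (F.cyc p.1).drive_loop_sq_ge hL, (F.cyc p.1).resistance_loop_pos hL a (F.pos p.1)⟩)
    (fun p => a ((F.cyc p.1).config p.2) ^ 2) (fun p _ => sq_nonneg _) (4 * (ℓ : ℝ) * B ^ 2) (by positivity)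
    (fun p hp => by
      have hs : p.2 ∈ F.good p.1 := (Finset.mem_sigma.1 hp).2
      have h1 := (F.cyc p.1).sq_mul_resistance_loop_le hL a (F.pos p.1) p.2 B (F.flat p.1 p.2 hs)
      have h2 : (4 : ℝ) * ((F.cyc p.1).n : ℝ) * B ^ 2 ≤ 4 * (ℓ : ℝ) * B ^ 2 := by
        have : ((F.cyc p.1).n : ℝ) ≤ (ℓ : ℝ) := by exact_mod_cast F.len_le p.1
        nlinarith [sq_nonneg B]
      exact h1.trans h2)
    ℓ (F.multiplicity_le hL) g
  exact h

end GoodStarterFamily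

end Summit.HubbardSuperconductivity.HubbardSuperconductivity.Theorems.AnisotropyChord.Stiffness.Doob
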